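import Literature.AnabelianGeometry.EtaleTheta.ThetaClassModL
import Literature.AnabelianGeometry.EtaleTheta.XuuCocycleOfCyclotome
import Literature.AnabelianGeometry.EtaleTheta.RigidOfSetting
import Literature.AnabelianGeometry.EtaleTheta.ContH1CyclicExtensionClasses
import HarnessLib

/-!
# [EtTh] Prop. 2.2 (ii) / Def. 2.7 in the §1 model: the cocycle input for `X̲̲` from the invariance of
# `η̈^Θ` modulo `l`

Mochizuki, *The étale theta function and its Frobenioid-theoretic manifestations*, Publ. RIMS **45**
(2009), §2: Prop. 2.2 (ii) (PRIMS PDF p. 37) "any section of the `H¹(G_K, Δ_Θ)`-torsor of splittings …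
determines a covering `X̲̲ → X̲`"; Def. 2.7 (p. 41) "the choice of a splitting of `D_x → G_K` … determines
… a specific class `∈ H¹(Π^tp_Ÿ, Δ_Θ ⊗ ℤ/lℤ)`, which may be thought of as a choice of `η̈^Θ` up to an
`(O_K^×)^l`-multiple", "`Π^tp_X̲/Π^tp_Ÿ ≅ (l·Z) × μ₂`" [cite: MochizukiEtTh2009, Def 2.7 p.41].

Cell abc-iut, layer L2, item N3 (existence of the choice `X̲̲`; seat abc-iut-L2-t7), residual input
"x1" of `XuuCocycleOfCyclotome.lean`. There the choice `X̲̲` (seat abc-iut-L2-t8's `DoubleUnderline`)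
was constructed from `XuuCocycleInput l`: a representative `f` of `η̈^Θ`, a continuous mod-`l·Δ_Θ`
cocycle `F` on `Π^tp_X̲ = toZ⁻¹(l·Z)` restricting to `f` modulo `l·Δ_Θ` on `Π^tp_Ÿ`, and the
normalisation `F ≡ θ` over `Δ_Θ`. THIS FILE inhabits `XuuCocycleInput l` from

* ONE class-level hypothesis on `η̈^Θ` — **invariance modulo `l`-th powers under `Π^tp_X̲`**:
  `∀ σ ∈ Π^tp_X̲, ∃ κ, σ·η̈^Θ = η̈^Θ · κ^l` in `H¹(Π^tp_Ÿ, Δ_Θ)` (written multiplicatively). In print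
  this is the content of Prop. 1.4 (ii) / Prop. 1.5 (iii) read modulo `l`: the generator of
  `Gal(Ÿ/Y) = μ₂` multiplies `η̈^Θ` by the Kummer class of `−1 = (−1)^l` (`Θ̈(−Ü) = −Θ̈(Ü)`), and
  `a ∈ l·Z` acts by `−2a·log(Ü) − a²·log(q̈) + log(±1)`, all `l`-th powers for `l` odd; the
  class-level suppliers are `ThetaKummerDeck.lean` (seat abc-iut-w5-d125) and the `Z`-translate files
  of seat abc-iut-L2-t1 — here it is an explicit HYPOTHESIS (no new `Prop` fact);
* seat abc-iut-L2-t1's named fact `Prop15iii` ([EtTh] Prop. 1.5 (iii): `η̈^Θ` restricts to `log(Θ)` on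
  `Δ_Θ`) — giving the normalisation `F ≡ θ` over `Δ_Θ` (residual "x2") through seat abc-iut-L2-t8's
  `etaDd_cocycle_apply`; `K = K̈` (`Sec2Hyps`), `Compat`, the cyclotome identification
  `CyclotomeMod 1 l` (`[Δ_Θ : l·Δ_Θ] = l`, `l·Δ_Θ` open) and `l` odd;

by the route: reduce coefficients modulo `l·Δ_Θ` (`Δ̄_Θ := Δ_Θ/l·Δ_Θ ⊆ (Π^tp_X)^Θ/l·Δ_Θ`, a finite
group of odd order `l` on which squaring is bijective and `H¹(−, Δ̄_Θ)` has exponent `l`, so the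
hypothesis becomes honest invariance — the bookkeeping file `ThetaClassModL.lean`), extend the reduced
class along `Π^tp_Ÿ = Π^tp_{Y₂} ≤ Π^tp_Y ≤ Π^tp_X̲` (index `2`, then `l·Z ≅ ℤ`) by seat
abc-iut-w5-d234's `ContH1.exists_contCocycle_extension_two_step` (`H²(ℤ/2, −) = 0 = H²(ℤ, −)` for these
coefficients), and lift values back to `Δ_Θ` by a section (continuous: `Δ̄_Θ` is discrete as `l·Δ_Θ` is
open). Results: `nonempty_xuuCocycleInput_of_invariance`, the choice
`XuuCocycleInput.ofInvariance`, and **`doubleUnderlineOfInvariance : E.DoubleUnderline l`** — the choice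
`X̲̲` with all of seat abc-iut-L2-t8's fields proved, from {`Compat`, `Sec2Hyps`, `Prop15iii`,
`CyclotomeMod 1 l`, `l` odd, invariance of `η̈^Θ` mod `l`-th powers}. Nothing here asserts that the
hypotheses hold for an actual curve; typed ≠ endorsed; no side is taken on any disputed claim.
-/

noncomputable section

namespace Literature.AnabelianGeometry.EtaleTheta

open Literature.AnabelianGeometry.SemiGraphs

namespace ThetaSetting

variable {p : ℕ} [Fact p.Prime] {D : ThetaSetting p}

/-! ### Invariance modulo `l`-th powers: a subgroup condition, reduced to the two generators -/

section Stabilizer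

variable [D.GtpYdd.Normal]

/-- Powers of odd exponent of an element of square `1`. [folklore] -/
private theorem pow_eq_self_of_sq_eq_one {M : Type*} [Monoid M] {κ : M} {n : ℕ} (hn : Odd n) (hκ : κ ^ 2 = 1) :
    κ ^ n = κ := by
  obtain ⟨m, rfl⟩ := hn
  rw [pow_succ, pow_mul, hκ, one_pow, one_mul]

/-- **The elements of `Π^tp_X` under which a class `x ∈ H¹(Π^tp_Ÿ, Δ_Θ)` is invariant modulo `n`-th
powers** (`σ·x = x·κ^n` for some `κ`) form a subgroup (the conjugation action is an action and a
homomorphism in `x`). [cite: MochizukiEtTh2009, Def 2.7 p.41] -/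
def invModPowStabilizer (x : D.H1 D.GtpYdd) (n : ℕ) : Subgroup D.PiTemp where
  carrier := {σ | ∃ κ : D.H1 D.GtpYdd, ContH1.conj D.toTheta D.DeltaTheta σ x = x * κ ^ n}
  one_mem' := ⟨1, by rw [ContH1.conj_one_apply, one_pow, mul_one]⟩
  mul_mem' := by
    rintro σ τ ⟨κ, hκ⟩ ⟨κ', hκ'⟩
    refine ⟨κ * ContH1.conj D.toTheta D.DeltaTheta σ κ', ?_⟩
    rw [ContH1.conj_mul_apply, hκ', map_mul, map_pow, hκ, mul_pow, mul_assoc]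
  inv_mem' := by
    rintro σ ⟨κ, hκ⟩
    refine ⟨(ContH1.conj D.toTheta D.DeltaTheta σ⁻¹ κ)⁻¹, ?_⟩
    have h := congrArg (ContH1.conj D.toTheta D.DeltaTheta σ⁻¹) hκ
    rw [ContH1.conj_inv_conj_apply, map_mul, map_pow] at h
    rw [inv_pow, eq_mul_inv_iff_mul_eq]
    exact h.symm

/-- Membership in `invModPowStabilizer`, unfolded. [cite: MochizukiEtTh2009, Def 2.7 p.41] -/
theorem mem_invModPowStabilizer_iff (x : D.H1 D.GtpYdd) (n : ℕ) (σ : D.PiTemp) :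
    σ ∈ invModPowStabilizer x n ↔
      ∃ κ : D.H1 D.GtpYdd, ContH1.conj D.toTheta D.DeltaTheta σ x = x * κ ^ n :=
  Iff.rfl

/-- `Π^tp_Ÿ` acts trivially (inner automorphisms), so lies in the stabilizer. [cite: MochizukiEtTh2009, Def 2.7 p.41] -/
theorem GtpYdd_le_invModPowStabilizer (x : D.H1 D.GtpYdd) (n : ℕ) :
    D.GtpYdd ≤ invModPowStabilizer x n :=
  fun σ hσ => ⟨1, by rw [ContH1.conj_eq_self_of_mem σ hσ x, one_pow, mul_one]⟩

/-- A `μ₂`-type generator: `ε·x = x·κ` with `κ² = 1` puts `ε` in the stabilizer for every ODD exponent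
(`κ = κ^n`). [cite: MochizukiEtTh2009, Def 2.7 p.41] -/
theorem mem_invModPowStabilizer_of_sq_eq_one (x : D.H1 D.GtpYdd) {n : ℕ} (hn : Odd n) {ε : D.PiTemp}
    {κ : D.H1 D.GtpYdd} (hκ : κ ^ 2 = 1) (h : ContH1.conj D.toTheta D.DeltaTheta ε x = x * κ) :
    ε ∈ invModPowStabilizer x n :=
  ⟨κ, by rw [pow_eq_self_of_sq_eq_one hn hκ]; exact h⟩

/-- **Reduction to the two generators of `Π^tp_X̲/Π^tp_Ÿ ≅ (l·Z) × μ₂`** (`K = K̈`): if a lift `t₁` of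
the generator of `Gal(Ÿ/Y)` and a lift `t` of `l ∈ Z` both stabilize `x` modulo `n`-th powers, then
so does all of `Π^tp_X̲`. [cite: MochizukiEtTh2009, Def 2.7 p.41] -/
theorem GtpXu_le_invModPowStabilizer (hS : D.Sec2Hyps) (x : D.H1 D.GtpYdd) (n : ℕ) {l : ℕ} (hl : l ≠ 0)
    {t₁ : D.PiTemp} (ht₁ : t₁ ∈ D.GtpY) (ht₁N : t₁ ∉ D.GtpYdd) (h₁ : t₁ ∈ invModPowStabilizer x n)
    {t : D.PiTemp} (ht : t ∈ D.GtpXu l) (hχt : D.toZDivL l hl ⟨t, ht⟩ = Multiplicative.ofAdd 1)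
    (h₂ : t ∈ invModPowStabilizer x n) :
    D.GtpXu l ≤ invModPowStabilizer x n := by
  intro σ hσ
  have hY : D.GtpYdd ≤ invModPowStabilizer x n := GtpYdd_le_invModPowStabilizer x n
  set k : ℤ := Multiplicative.toAdd (D.toZDivL l hl ⟨σ, hσ⟩) with hk
  have hmem : σ * t ^ (-k) ∈ D.GtpXu l := mul_mem hσ (zpow_mem ht _)
  have hY' : σ * t ^ (-k) ∈ D.GtpY := by
    rw [← D.toZDivL_eq_one_iff l hl ⟨σ * t ^ (-k), hmem⟩]
    have e : (⟨σ * t ^ (-k), hmem⟩ : D.GtpXu l) = ⟨σ, hσ⟩ * ⟨t, ht⟩ ^ (-k) :=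
      Subtype.ext (by simp only [Subgroup.coe_mul, SubgroupClass.coe_zpow])
    rw [e, map_mul, map_zpow, hχt, ← ofAdd_zsmul, smul_eq_mul, mul_one, hk, ofAdd_neg, ofAdd_toAdd,
      mul_inv_cancel]
  have hS1 : σ * t ^ (-k) ∈ invModPowStabilizer x n := by
    by_cases hdd : σ * t ^ (-k) ∈ D.GtpYdd
    · exact hY hdd
    · have h3 : σ * t ^ (-k) * t₁⁻¹ ∈ D.GtpYdd := D.mul_inv_mem_GtpYdd hS hY' hdd ht₁ ht₁N
      have e : σ * t ^ (-k) = (σ * t ^ (-k) * t₁⁻¹) * t₁ := by group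
      rw [e]
      exact mul_mem (hY h3) h₁
  have e : σ = (σ * t ^ (-k)) * t ^ k := by group
  rw [e]
  exact mul_mem hS1 (zpow_mem h₂ _)

/-- The same in the shape of the hypothesis `hinv` below: invariance of `x` modulo `n`-th powers under
all of `Π^tp_X̲` from the two generator statements. [cite: MochizukiEtTh2009, Def 2.7 p.41] -/
theorem invariant_modPow_of_generators (hS : D.Sec2Hyps) (x : D.H1 D.GtpYdd) (n : ℕ) {l : ℕ}
    (hl : l ≠ 0) {t₁ : D.PiTemp} (ht₁ : t₁ ∈ D.GtpY) (ht₁N : t₁ ∉ D.GtpYdd)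
    (h₁ : ∃ κ : D.H1 D.GtpYdd, ContH1.conj D.toTheta D.DeltaTheta t₁ x = x * κ ^ n)
    {t : D.PiTemp} (ht : t ∈ D.GtpXu l) (hχt : D.toZDivL l hl ⟨t, ht⟩ = Multiplicative.ofAdd 1)
    (h₂ : ∃ κ : D.H1 D.GtpYdd, ContH1.conj D.toTheta D.DeltaTheta t x = x * κ ^ n) :
    ∀ σ ∈ D.GtpXu l, ∃ κ : D.H1 D.GtpYdd, ContH1.conj D.toTheta D.DeltaTheta σ x = x * κ ^ n :=
  fun _ hσ => GtpXu_le_invModPowStabilizer hS x n hl ht₁ ht₁N h₁ ht hχt h₂ hσ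

end Stabilizer

namespace EtaleThetaData

variable {E : D.EtaleThetaData}

/-! ### The cocycle input from the invariance of `η̈^Θ` modulo `l` -/

/-- **The cocycle input for `X̲̲` exists** given: `Compat`, `K = K̈`, Prop. 1.5 (iii) (`η̈^Θ` is `log(Θ)` on
`Δ_Θ`), the cyclotome identification at level `(1, l)`, `l` odd, and the invariance of `η̈^Θ` modulo
`l`-th powers under `Π^tp_X̲` ("`Π^tp_X̲/Π^tp_Ÿ ≅ (l·Z) × μ₂`", p. 41; Prop. 1.4 (ii), Prop. 1.5 (iii)
read modulo `l`). Route: reduce `η̈^Θ` modulo `l`, extend along `Π^tp_Ÿ ≤ Π^tp_Y ≤ Π^tp_X̲`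
(`ContH1.exists_contCocycle_extension_two_step`), lift values to `Δ_Θ` by a section.
[cite: MochizukiEtTh2009, Def 2.7 p.41] -/
theorem nonempty_xuuCocycleInput_of_invariance (hC : D.Compat) (hS : D.Sec2Hyps) [D.GtpYdd.Normal]
    (h15 : Prop15iii E hC) {l : ℕ+} (μ : D.CyclotomeMod 1 l) (hl : Odd (l : ℕ))
    (hinv : ∀ σ ∈ D.GtpXu l, ∃ κ : D.H1 D.GtpYdd,
      ContH1.conj D.toTheta D.DeltaTheta σ E.etaDd = E.etaDd * κ ^ (l : ℕ)) :
    Nonempty (E.XuuCocycleInput l) := by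
  classical
  have hl0 : (l : ℕ) ≠ 0 := l.ne_zero
  haveI : D.GtpY.Normal := by
    change D.toZ.ker.Normal
    infer_instance
  haveI := D.discreteTopology_DeltaThetaBar μ
  -- a representative of `η̈^Θ` and its reduction modulo `l`
  obtain ⟨f₀, hf₀⟩ : ∃ f₀ : contCocycles D.toTheta D.DeltaTheta D.GtpYdd,
      (QuotientGroup.mk f₀ : D.H1 D.GtpYdd) = E.etaDd := QuotientGroup.mk_surjective _
  have hf₀' : ContH1.mk f₀.1 f₀.2 = E.etaDd := hf₀
  set f := ContH1.pushCocycle D.toTheta D.DeltaTheta (D.modL l) (D.continuous_modL l)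
    (D.DeltaThetaBar l) le_rfl D.GtpYdd f₀ with hf
  have hfclass : (QuotientGroup.mk f : ContH1 (D.toThetaModL l) (D.DeltaThetaBar l) D.GtpYdd) =
      redModL l D.GtpYdd E.etaDd := by
    rw [← hf₀]
    rfl
  -- lifts of the two generators of `Π^tp_X̲/Π^tp_Ÿ ≅ (l·Z) × μ₂`
  obtain ⟨t₁, ht₁, ht₁N⟩ := D.exists_mem_GtpY_not_mem_GtpYdd hS
  obtain ⟨t, ht, hχt⟩ := D.exists_toZDivL_eq l hl0
  -- invariance of the reduced class under both, with witnesses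
  have hinv₁c : ContH1.conj (D.toThetaModL l) (D.DeltaThetaBar l) t₁
      (QuotientGroup.mk f : ContH1 (D.toThetaModL l) (D.DeltaThetaBar l) D.GtpYdd) =
        QuotientGroup.mk f := by
    rw [hfclass]
    exact conj_redModL_etaDd_eq hinv (D.GtpY_le_GtpXu l ht₁)
  have hinvc : ContH1.conj (D.toThetaModL l) (D.DeltaThetaBar l) t
      (QuotientGroup.mk f : ContH1 (D.toThetaModL l) (D.DeltaThetaBar l) D.GtpYdd) =
        QuotientGroup.mk f := by
    rw [hfclass]
    exact conj_redModL_etaDd_eq hinv ht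
  obtain ⟨b₁, hb₁⟩ := ContH1.exists_witness_of_conj_eq f hinv₁c
  obtain ⟨b, hb⟩ := ContH1.exists_witness_of_conj_eq f hinvc
  -- the two-step extension to `Π^tp_X̲`
  obtain ⟨F', hF'⟩ := ContH1.exists_contCocycle_extension_two_step (H := D.GtpXu l)
    (D.continuous_toThetaModL l) (DoubleUnderline.isOpen_GtpYdd hS) D.isOpen_ker_toZ
    D.GtpYdd_le_GtpY (D.GtpY_le_GtpXu l) ht₁ ht₁N
    (fun h hh hhN => D.mul_inv_mem_GtpYdd hS hh hhN ht₁ ht₁N)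
    (D.toZDivL l hl0) (fun h => D.toZDivL_eq_one_iff l hl0 h) ht hχt
    (D.sq_bijective_DeltaThetaBar μ hl) f b₁ b hb₁ hb
  -- a section of `Δ_Θ → Δ̄_Θ`
  have hsec0 : ∀ a : D.DeltaThetaBar l, ∃ y : D.DeltaTheta,
      (((y : D.GtpTheta) : D.GtpThetaModL l)) = (a : D.GtpThetaModL l) := by
    rintro ⟨x, y, hy, hyx⟩
    exact ⟨⟨y, hy⟩, hyx⟩
  choose sec hsec using hsec0
  -- the cocycle identity of `F'`, in the ambient quotient group
  have hF'co : ∀ g h : D.GtpXu l, ((F'.1 (g * h) : D.DeltaThetaBar l) : D.GtpThetaModL l) =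
      (F'.1 g : D.GtpThetaModL l) * ((D.toThetaModL l g) * (F'.1 h : D.GtpThetaModL l) *
        (D.toThetaModL l g)⁻¹) := by
    intro g h
    have e := congrArg Subtype.val (F'.2.2 g h)
    simpa only [Subgroup.coe_mul, MulAut.conjNormal_apply] using e
  refine ⟨{ f := f₀
            mk_f := hf₀'
            F := fun g => sec (F'.1 g)
            continuous_F := continuous_of_discreteTopology.comp F'.2.1
            cocycle_F := ?_
            F_res := ?_
            F_theta := ?_ }⟩
  · -- cocycle modulo `l·Δ_Θ`
    intro g h
    rw [Subgroup.mem_subgroupOf, ← QuotientGroup.eq_one_iff]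
    simp only [Subgroup.coe_mul, Subgroup.coe_inv, MulAut.conjNormal_apply, QuotientGroup.mk_mul,
      QuotientGroup.mk_inv, hsec]
    rw [hF'co]
    exact inv_mul_cancel _
  · -- restriction to `Π^tp_Ÿ`
    intro h
    rw [Subgroup.mem_subgroupOf, ← QuotientGroup.eq_one_iff]
    simp only [Subgroup.coe_mul, Subgroup.coe_inv, QuotientGroup.mk_mul, QuotientGroup.mk_inv, hsec]
    rw [hF' h]
    exact inv_mul_cancel _
  · -- normalisation over `Δ_Θ`: such `δ` lie in `Π^tp_Ÿ`, where `F ≡ f₀ = θ` (Prop. 1.5 (iii))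
    intro δ hΔ hθ
    have hY : (δ : D.PiTemp) ∈ D.GtpYdd := (DoubleUnderline.mem_GtpYdd_of_toTheta_mem hS hθ).1
    have hδ : δ = ⟨((⟨(δ : D.PiTemp), hY⟩ : D.GtpYdd) : D.PiTemp),
        D.GtpY_le_GtpXu l (D.GtpYdd_le_GtpY hY)⟩ := Subtype.ext rfl
    have hval : ((F'.1 δ : D.DeltaThetaBar l) : D.GtpThetaModL l) =
        (D.modL l) (f₀.1 ⟨(δ : D.PiTemp), hY⟩ : D.GtpTheta) := by
      conv_lhs => rw [hδ]
      rw [hF' ⟨(δ : D.PiTemp), hY⟩]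
      rfl
    have hθf : ((f₀.1 ⟨(δ : D.PiTemp), hY⟩ : D.DeltaTheta) : D.GtpTheta) = D.toTheta (δ : D.PiTemp) :=
      etaDd_cocycle_apply hC h15 f₀ hf₀' ⟨(δ : D.PiTemp), hY⟩ hθ
    rw [Subgroup.mem_subgroupOf, ← QuotientGroup.eq_one_iff]
    simp only [Subgroup.coe_mul, Subgroup.coe_inv, QuotientGroup.mk_mul, QuotientGroup.mk_inv, hsec]
    rw [hval, hθf]
    exact inv_mul_cancel _

/-- **The cocycle input for `X̲̲` from the invariance of `η̈^Θ` modulo `l`** (a choice, by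
`Classical.choice`, of the data whose existence is `nonempty_xuuCocycleInput_of_invariance`).
[cite: MochizukiEtTh2009, Def 2.7 p.41] -/
def XuuCocycleInput.ofInvariance (hC : D.Compat) (hS : D.Sec2Hyps) [D.GtpYdd.Normal]
    (h15 : Prop15iii E hC) {l : ℕ+} (μ : D.CyclotomeMod 1 l) (hl : Odd (l : ℕ))
    (hinv : ∀ σ ∈ D.GtpXu l, ∃ κ : D.H1 D.GtpYdd,
      ContH1.conj D.toTheta D.DeltaTheta σ E.etaDd = E.etaDd * κ ^ (l : ℕ)) :
    E.XuuCocycleInput l :=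
  (nonempty_xuuCocycleInput_of_invariance hC hS h15 μ hl hinv).some

/-- **The choice `X̲̲` in the §1 model from the printed §1 inputs** (Prop. 2.2 (ii) / Def. 2.5 (i) /
Def. 2.7): a `DoubleUnderline` in the sense of seat abc-iut-L2-t8 — all fields proved — from `Compat`,
`K = K̈`, Prop. 1.5 (iii), the cyclotome identification `Δ_Θ/l ≅ μ_l`, `l` odd, and the invariance of
`η̈^Θ` modulo `l`-th powers under `Π^tp_X̲`. [cite: MochizukiEtTh2009, Def 2.7 p.41] -/
def doubleUnderlineOfInvariance (hC : D.Compat) (hS : D.Sec2Hyps) [D.GtpYdd.Normal]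
    (h15 : Prop15iii E hC) {l : ℕ+} (μ : D.CyclotomeMod 1 l) (hl : Odd (l : ℕ))
    (hinv : ∀ σ ∈ D.GtpXu l, ∃ κ : D.H1 D.GtpYdd,
      ContH1.conj D.toTheta D.DeltaTheta σ E.etaDd = E.etaDd * κ ^ (l : ℕ)) :
    E.DoubleUnderline l :=
  doubleUnderlineOfCyclotomeMod hS μ hl (XuuCocycleInput.ofInvariance hC hS h15 μ hl hinv)

/-- Hence, under these inputs, **a choice `X̲̲` exists** (`E.DoubleUnderline l` is inhabited).
[cite: MochizukiEtTh2009, Def 2.7 p.41] -/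
theorem nonempty_doubleUnderline_of_invariance (hC : D.Compat) (hS : D.Sec2Hyps) [D.GtpYdd.Normal]
    (h15 : Prop15iii E hC) {l : ℕ+} (μ : D.CyclotomeMod 1 l) (hl : Odd (l : ℕ))
    (hinv : ∀ σ ∈ D.GtpXu l, ∃ κ : D.H1 D.GtpYdd,
      ContH1.conj D.toTheta D.DeltaTheta σ E.etaDd = E.etaDd * κ ^ (l : ℕ)) :
    Nonempty (E.DoubleUnderline l) :=
  ⟨doubleUnderlineOfInvariance hC hS h15 μ hl hinv⟩

end EtaleThetaData

end ThetaSetting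

end Literature.AnabelianGeometry.EtaleTheta

end
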